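import Mathlib
import HarnessLib
import Literature.MathematicalPhysics.KineticTheory.HardSphereEuler
import Literature.Analysis.FluidPDE.HardSphereCollisionRecord

/-!
# Crux `InformationPercolationEngine.CollisionRate` (stmt-AtomisticToContinuum-13481) —
ideator 2, round 1: first lemmas of the two lines (typed, not proved)

ROUTE-FILE-FREE COPY for the crux directory: identical to the folder's `Sketch.lean` (item evidence, rc 0 WITH the
route import and the shapes concluding `InformationPercolationEngine.CollisionRate` BY NAME) except that the two
`Card…Shape` defs take the crux as a Prop parameter, so that this file does not import the route Theses file (the farm
snapshot of that file was incoherent at publish time, exit-75 semantics).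

Card 1 `hazard-fairness-compensator`: `HazardFairRelEquilibrium` (the occurrence twin of the
route's crux 2 `KickFairRelEquilibrium`: the windowed collision COUNT of each sphere, compensated
by its conditional expectation under the INVARIANT law given the coarse present, has small
L¹(local Gibbs) norm uniformly over coarse-measurable weights).

Card 2 `manufactured-noise-positional-sdpi`: the Maxwell-refreshed one-step kernel on POSITIONS
(`hmcStep`), its two structural facts (`HmcPreservesUniform`, `HmcKlMonotone` — data processing),
and the velocity-side input `VelocityEntropySaturation` (OVY's step (B), asked of the engine).
-/

noncomputable section

namespace Summit.AtomisticToContinuum.HydrodynamicLimit.Cruxes.CollisionRate.IdeatorTwo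

open scoped BigOperators Topology Classical MeasureTheory ProbabilityTheory ENNReal
open Filter Set Function MeasureTheory
open Literature.MathematicalPhysics.KineticTheory Literature.Analysis.FluidPDE

/-! ## Card 1 — hazard fairness relative to equilibrium -/

/-- **HazardFairRelEquilibrium** (card 1, the dynamical stub; occurrence twin of
`KickFairRelEquilibrium`). Windows of length `w = a (N+1)^{-1/3}` (a fraction `a` of a mean
free time); `D_{i,k}` = number of collisions of sphere `i` in window `k`; coarse present
`p_{i,k}` = (`r`-cells and exact velocities of ALL spheres at the window start, label `i`);
`κ_{i,k} = E_G[D_{i,k} | σ(p_{i,k})]` under the INVARIANT law `G = localGibbsLaw σ 1 0 1 N Φ`.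
CLAIM: uniformly over measurable weights `|h_{i,k}| ≤ 1` of the coarse present, the compensated
count `(ε/(N+1)) Σ_i Σ_k h_{i,k}(p_{i,k}) (D_{i,k} − κ_{i,k})` has `L¹(local Gibbs)` norm `≤ δ`
for `N ≥ N₀(δ, a, r, τ, σ, profiles)`. -/
def HazardFairRelEquilibrium : Prop :=
  ∀ (a₀ θ₀ : T3 → ℝ) (u₀ : T3 → V3), Continuous a₀ → Continuous θ₀ → Continuous u₀ →
    (∀ x, 0 < a₀ x) → (∀ x, 0 < θ₀ x) →
    ∃ σ₀ : ℝ, 0 < σ₀ ∧ ∀ σ : ℝ, 0 < σ → σ < σ₀ →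
    ∀ Φ : (N : ℕ) → HardSphereFlow (Torus.geometry (Fin 3)) (hsDiameter σ N) (N + 1),
    ∀ τ : ℝ, 0 < τ → ∀ r : ℝ, 0 < r → ∀ a : ℝ, 0 < a → ∀ δ : ℝ, 0 < δ →
    ∃ N₀ : ℕ, ∀ N : ℕ, N₀ ≤ N →
    ∀ h : Fin (N + 1) → ℕ → ((Fin (N + 1) → (Fin 3 → ℤ) × V3) × Fin (N + 1)) → ℝ,
      (∀ i k, Measurable (h i k)) → (∀ i k p, |h i k p| ≤ 1) →
    let ε := hsDiameter σ N
    let G : Geometry (Fin 3) T3 := Torus.geometry (Fin 3)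
    let q : T3 → (Fin 3 → ℤ) := Torus.coarseCell r
    let γ : Config (N + 1) (Fin 3) T3 → ℝ → Config (N + 1) (Fin 3) T3 := fun z s => (Φ N).flow s z
    let w : ℝ := a * ((N + 1 : ℕ) : ℝ) ^ (-(1 / 3 : ℝ))
    let Kw : ℕ := ⌊τ / w⌋₊
    let D : Fin (N + 1) → ℕ → Config (N + 1) (Fin 3) T3 → ℝ := fun i k z =>
      if z ∈ (Φ N).good then
        (Set.ncard (collisionTimesOf G ε (γ z) i ∩ Set.Ico ((k : ℝ) * w) (((k : ℝ) + 1) * w)) : ℝ)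
      else 0
    let Pst : Config (N + 1) (Fin 3) T3 → Fin (N + 1) → ℕ →
        (Fin (N + 1) → (Fin 3 → ℤ) × V3) × Fin (N + 1) := fun z i k =>
      if z ∈ (Φ N).good then (coarseConfig q (γ z ((k : ℝ) * w)), i) else (fun _ => (0, 0), i)
    let κ : Fin (N + 1) → ℕ → Config (N + 1) (Fin 3) T3 → ℝ := fun i k =>
      MeasureTheory.condExp (MeasurableSpace.comap (fun z => Pst z i k) inferInstance)
        (localGibbsLaw σ (fun _ => 1) (fun _ => 0) (fun _ => 1) N (Φ N)) (D i k)
    let S : Config (N + 1) (Fin 3) T3 → ℝ := fun z =>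
      ε / (N + 1 : ℝ) * ∑ i : Fin (N + 1), ∑ k ∈ Finset.range Kw,
        h i k (Pst z i k) * (D i k z - κ i k z)
    ∫⁻ z, ENNReal.ofReal |S z| ∂(localGibbsLaw σ a₀ u₀ θ₀ N (Φ N)) ≤ ENNReal.ofReal δ

/-- The reduction shape card 1 bets on (informal content in the card):
hazard fairness + the equilibrium window-hazard law + mesoscale regularity ⇒ the crux. The three
antecedents after the first are card-1 stubs to be typed by crux-plan; here only the shape is
recorded, with the crux decl BY NAME as conclusion. -/
def CardOneShape (CollisionRate EqWindowHazard MesoscaleRegularity : Prop) : Prop :=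
  HazardFairRelEquilibrium → EqWindowHazard → MesoscaleRegularity → CollisionRate

/-! ## Card 2 — noise manufactured from velocity chaos: the positional HMC kernel -/

variable (σ : ℝ) (N : ℕ)

/-- Position projection of a phase point. -/
def pos (z : Config (N + 1) (Fin 3) T3) : Fin (N + 1) → T3 := fun i => (z i).1

/-- Re-assembling a phase point from positions and velocities. -/
def zipPV (p : (Fin (N + 1) → T3) × (Fin (N + 1) → V3)) : Config (N + 1) (Fin 3) T3 :=
  fun i => (p.1 i, p.2 i)

/-- Product of standard Maxwellians on the velocities (the refresh law; unit temperature, zero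
drift — the invariant law's velocity marginal). -/
def maxwellPi : Measure (Fin (N + 1) → V3) :=
  Measure.pi fun _ : Fin (N + 1) =>
    (volume : Measure V3).withDensity fun v => ENNReal.ofReal (globalMaxwellian v)

/-- **The positional HMC step**: refresh all velocities from `maxwellPi`, run the deterministic
hard-sphere flow for time `t`, forget the velocities. A Markov operator on laws of POSITION
configurations. -/
def hmcStep (Φ : HardSphereFlow (Torus.geometry (Fin 3)) (hsDiameter σ N) (N + 1)) (t : ℝ)
    (P : Measure (Fin (N + 1) → T3)) : Measure (Fin (N + 1) → T3) :=
  ((P.prod (maxwellPi N)).map (zipPV N)).map (pos N ∘ Φ.flow t)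

/-- The uniform (Lebesgue) law on admissible position configurations (hard cores of diameter
`hsDiameter σ N` on `𝕋³`); total mass = the free volume. -/
def posUniform : Measure (Fin (N + 1) → T3) :=
  (volume : Measure (Fin (N + 1) → T3)).restrict
    {p | (fun i => (p i, (0 : V3))) ∈ hardSphereDomain (Torus.geometry (Fin 3)) (N + 1) (hsDiameter σ N)}

/-- **HmcPreservesUniform** (card 2, first structural fact; provable now from Liouville
invariance `HardSphereFlow.measurePreserving` + conservation of kinetic energy
`IsHardSphereTrajectory.configEnergy_eq`, the Maxwellian product being a function of it):
the uniform admissible law is invariant under every positional HMC step. -/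
def HmcPreservesUniform : Prop :=
  ∀ (Φ : HardSphereFlow (Torus.geometry (Fin 3)) (hsDiameter σ N) (N + 1)) (t : ℝ),
    hmcStep σ N Φ t (posUniform σ N) = posUniform σ N

/-- **HmcKlMonotone** (card 2, second structural fact; data processing
`Literature.Probability.Entropy.klDiv_comp_le` + `HmcPreservesUniform`): one positional HMC step
cannot increase the relative entropy to the uniform admissible law — equivalently the positional
Shannon entropy is non-decreasing, `I_t(P) := H(P|U) − H(P K_t|U) ≥ 0`. -/
def HmcKlMonotone : Prop :=
  ∀ (Φ : HardSphereFlow (Torus.geometry (Fin 3)) (hsDiameter σ N) (N + 1)) (t : ℝ)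
    (P : Measure (Fin (N + 1) → T3)) [IsProbabilityMeasure P],
    InformationTheory.klDiv (hmcStep σ N Φ t P) (posUniform σ N)
      ≤ InformationTheory.klDiv P (posUniform σ N)

/-- Local Maxwellian product with continuous fields `(u, θ)` attached to a position
configuration (the reference for OVY's step (B)). -/
def localMaxwellPi (u : T3 → V3) (θ : T3 → ℝ) (p : Fin (N + 1) → T3) : Measure (Fin (N + 1) → V3) :=
  Measure.pi fun i : Fin (N + 1) =>
    (volume : Measure V3).withDensity fun v => ENNReal.ofReal (localMaxwellian 1 (θ (p i)) (u (p i)) v)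

/-- The law "positions as under `f`, velocities conditionally an independent local-Maxwellian
product": `P_f ⊗ M_{u,θ}` re-assembled on phase space (`Measure.bind`; measurability of the
field maps is part of the stub, not of this shape). -/
def velocityProductReference (u : T3 → V3) (θ : T3 → ℝ)
    (f : Measure (Config (N + 1) (Fin 3) T3)) : Measure (Config (N + 1) (Fin 3) T3) :=
  (f.map (pos N)).bind fun p => (localMaxwellPi N u θ p).map fun w => zipPV N (p, w)

/-- **VelocityEntropySaturation** (card 2, the engine-side input = OVY 1993 §4 step (B) for hard
spheres, in specific relative entropy): along the evolved local Gibbs law, at every time `s ≤ τ`,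
the conditional law of the velocities given the positions is within `o(N)` nats of SOME
continuous local-Maxwellian product. -/
def VelocityEntropySaturation : Prop :=
  ∀ (a₀ θ₀ : T3 → ℝ) (u₀ : T3 → V3), Continuous a₀ → Continuous θ₀ → Continuous u₀ →
    (∀ x, 0 < a₀ x) → (∀ x, 0 < θ₀ x) →
    ∃ σ₀ : ℝ, 0 < σ₀ ∧ ∀ σ : ℝ, 0 < σ → σ < σ₀ →
    ∀ Φ : (N : ℕ) → HardSphereFlow (Torus.geometry (Fin 3)) (hsDiameter σ N) (N + 1),
    ∀ τ : ℝ, 0 < τ →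
    ∃ (u : ℝ → T3 → V3) (θ : ℝ → T3 → ℝ), Continuous (uncurry u) ∧ Continuous (uncurry θ) ∧
      (∀ s x, 0 < θ s x) ∧
    ∀ δ : ℝ, 0 < δ → ∃ N₀ : ℕ, ∀ N : ℕ, N₀ ≤ N → ∀ s ∈ Set.Icc (0 : ℝ) τ,
      InformationTheory.klDiv ((Φ N).lawAt (localGibbsLaw σ a₀ u₀ θ₀ N (Φ N)) s)
        (velocityProductReference N (u s) (θ s) ((Φ N).lawAt (localGibbsLaw σ a₀ u₀ θ₀ N (Φ N)) s))
        ≤ ENNReal.ofReal (δ * (N + 1))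

/-- The reduction shape card 2 bets on: velocity entropy saturation + a KL-contraction (SDPI)
constant for the block positional HMC kernel below a packing threshold (+ technical stubs)
⇒ the crux, concluded BY NAME. -/
def CardTwoShape (CollisionRate PositionalBlockSDPI TechnicalStubs : Prop) : Prop :=
  VelocityEntropySaturation → PositionalBlockSDPI → TechnicalStubs → CollisionRate

end Summit.AtomisticToContinuum.HydrodynamicLimit.Cruxes.CollisionRate.IdeatorTwo

end
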